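import Literature.RepresentationTheory.BorelWallach2000.UpqHarmonicHodgeDecomposition
import HarnessLib

/-!
# FLOOR-0 P3b «ENGINE local packets» — infrastructure I: the `𝔭`-part of `𝔲(α, β)` through `J = ad z₀` and the
# raising ∕ nullity operators `pOp c X = ρX + c·ρ(JX)` on a `(𝔤, K)`-module of `U(α, β)`

Cell hodgecm-mathlib, FLOOR 0, crux item H413 = stmt-HodgeConjecture-24833; sub-line
`Cruxes/H413/Lines/F0_EngineLocalPackets.lean` (F0P3b-plan, ed. 1 808dda7d).  Helper file (two light definitions `pPart`,
`pOp` + lemmas), author F0P3-p01 (g2); consumed by `F0P3bPNullGeneration` (the generation lemma) and the closers of the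
registered stubs T6a (purity), T6b (`dim ≤ 1`), T6c (rigidity).  No unitarity, admissibility or classification is used
anywhere in this chain — only the `(𝔤, K)`-axiom `ad_compat`, irreducibility, and the complex-structure element `z₀`.

Content ([BorelWallach2000, II §4.1–4.2]).  `pPart α β = {X ∈ 𝔲(α,β) | ⁅z₀, ⁅z₀, X⁆⁆ = −X}` is the `𝔭` of the Cartan
decomposition, characterised WITHOUT complexifying (`J = ad z₀` kills `𝔨`, squares to `−1` on `𝔭`); it contains the frame
`x_s` (`upqPBasis`), is `ad 𝔨`-, `J`- and `Ad K`-stable, and `𝔭 = Σ_s ℝ x_s` (`exists_sum_upqPBasis_of_mem_pPart`).  For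
`c ∈ ℂ`, `pOp ρ𝔤 c X = ρ𝔤 X + c · ρ𝔤 ⁅z₀, X⁆`: with `μ = δ i` (`μ² = −1`), `N = pOp μ` is the `𝔭^{−δ}`-NULLITY operator of
the line's `IsPNull` ∕ ★ T3j and `P = pOp (−μ)` the RAISING operator ("the action of `𝔭^{δ}`").  Commutators:
`[ρz₀, pOp c X] = −c · pOp c X` (`X ∈ 𝔭`, `c² = −1`), `[ρW, pOp c X] = pOp c ⁅W, X⁆` (`W ∈ 𝔨`),
`ρK k ∘ pOp c X = pOp c (Ad k X) ∘ ρK k`, and `[pOp c X, pOp c' Y] ∈ ρ(𝔨) + ℂρ(𝔨)` for `X, Y ∈ 𝔭` (`[𝔭, 𝔭] ⊆ 𝔨`).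

HONEST LABEL: HC_CM is proved only modulo the printed citations until rung 0 closes; this file discharges none of them.
-/

-- Mathlib idiom (as in `GKModules`, `GKCohomology`, the `Upq*` files and the Lines file): commutator bracket on `Module.End`
attribute [local instance 100] LieRing.ofAssociativeRing

set_option autoImplicit false
set_option linter.dupNamespace false

noncomputable section

namespace Summit.HodgeConjecture.HodgeConjecture.Cruxes.H413.F0P3bPPartOperators

open Literature.Algebra.Lie Literature.Algebra.Lie.ChevalleyEilenberg
open Literature.NumberTheory.Automorphic
open Literature.RepresentationTheory.BorelWallach2000
open Literature.RepresentationTheory.KonnoKonno2007 Literature.RepresentationTheory.KonnoKonno2007.RealDualPair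
open Literature.RepresentationTheory.KonnoKonno2007.RealDualPair.UForm

variable {α β : Type} [Fintype α] [DecidableEq α] [Fintype β] [DecidableEq β]

/-! ## §1 The `𝔭`-part of `𝔲(α, β)` through `J = ad z₀`: `𝔭 = {X | J²X = −X}` -/

section PPart

/-- **The `𝔭`-part of `𝔲(α, β)`** as a real subspace, characterised through the complex-structure element:
`X ∈ 𝔭 ⟺ ⁅z₀, ⁅z₀, X⁆⁆ = −X` (`J = ad z₀` kills `𝔨` and squares to `−1` on `𝔭`, `𝔤 = 𝔨 ⊕ 𝔭`).
[cite: BorelWallach2000, II §4.1] -/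
def pPart (α β : Type) [Fintype α] [DecidableEq α] [Fintype β] [DecidableEq β] :
    Submodule ℝ (uFormGroup α β).lie where
  carrier := {X | ⁅upqZ0 α β, ⁅upqZ0 α β, X⁆⁆ = -X}
  add_mem' {X Y} hX hY := by
    simp only [Set.mem_setOf_eq] at hX hY ⊢
    rw [lie_add, lie_add, hX, hY, neg_add]
  zero_mem' := by simp only [Set.mem_setOf_eq, lie_zero, neg_zero]
  smul_mem' r X hX := by
    simp only [Set.mem_setOf_eq] at hX ⊢
    rw [lie_smul, lie_smul, hX, smul_neg]

/-- Membership in `𝔭`. [cite: BorelWallach2000, II §4.1] -/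
theorem mem_pPart_iff (X : (uFormGroup α β).lie) : X ∈ pPart α β ↔ ⁅upqZ0 α β, ⁅upqZ0 α β, X⁆⁆ = -X := Iff.rfl

/-- `−X_{cE_p} = X_{−cE_p}`. [cite: BorelWallach2000, VI 4.8 (3)] -/
theorem neg_upqUnit (p : α × β) (c : ℂ) : -upqUnit p c = upqUnit p (-c) := by
  rw [← neg_one_smul ℝ (upqUnit p c), upq_real_smul_upqUnit]
  congr 1
  push_cast
  ring

/-- The generators `X_{cE_p}` lie in `𝔭`: `J² X_{cE_p} = X_{i²cE_p} = −X_{cE_p}`. [cite: BorelWallach2000, II §4.1] -/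
theorem upqUnit_mem_pPart (p : α × β) (c : ℂ) : upqUnit p c ∈ pPart α β := by
  rw [mem_pPart_iff, lie_upqZ0_upqUnit, lie_upqZ0_upqUnit, neg_upqUnit, ← mul_assoc, Complex.I_mul_I, neg_one_mul]

/-- The frame vectors `x_s` lie in `𝔭`. [cite: BorelWallach2000, II §1.1 (5)] -/
theorem upqPBasis_mem_pPart (s : (α × β) × Fin 2) : upqPBasis s ∈ pPart α β :=
  upqUnit_mem_pPart _ _

/-- `J` kills `𝔨`. [cite: BorelWallach2000, II §4.1] -/
theorem lie_upqZ0_eq_zero_of_mem_kInLie (W : (uFormGroup α β).lie) (hW : W ∈ (uFormGroup α β).kInLie) :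
    ⁅upqZ0 α β, W⁆ = 0 :=
  upq_isComplexStructureElement.lie_eq_zero W hW

/-- `J` commutes with `ad W` for `W ∈ 𝔨` (`z₀` is central in `𝔨`). [cite: BorelWallach2000, II §4.1] -/
theorem lie_upqZ0_lie_of_mem_kInLie (W : (uFormGroup α β).lie) (hW : W ∈ (uFormGroup α β).kInLie)
    (X : (uFormGroup α β).lie) : ⁅upqZ0 α β, ⁅W, X⁆⁆ = ⁅W, ⁅upqZ0 α β, X⁆⁆ := by
  rw [leibniz_lie, lie_upqZ0_eq_zero_of_mem_kInLie W hW, zero_lie, zero_add]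

/-- `𝔭` is `ad 𝔨`-stable. [cite: BorelWallach2000, II §4.1] -/
theorem lie_mem_pPart (W : (uFormGroup α β).lie) (hW : W ∈ (uFormGroup α β).kInLie) (X : (uFormGroup α β).lie)
    (hX : X ∈ pPart α β) : ⁅W, X⁆ ∈ pPart α β := by
  rw [mem_pPart_iff] at hX ⊢
  rw [lie_upqZ0_lie_of_mem_kInLie W hW, lie_upqZ0_lie_of_mem_kInLie W hW, hX, lie_neg]

/-- `𝔭` is `J`-stable. [cite: BorelWallach2000, II §4.1] -/
theorem lie_upqZ0_mem_pPart (X : (uFormGroup α β).lie) (hX : X ∈ pPart α β) : ⁅upqZ0 α β, X⁆ ∈ pPart α β := by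
  rw [mem_pPart_iff] at hX ⊢
  rw [hX, lie_neg]

/-- `𝔭` is `Ad K`-stable (`Ad k z₀ = z₀`). [cite: BorelWallach2000, II §4.1] -/
theorem Ad_mem_pPart (k : (uFormGroup α β).maximalCompact) (X : (uFormGroup α β).lie) (hX : X ∈ pPart α β) :
    (uFormGroup α β).Ad (Subgroup.inclusion (uFormGroup α β).maximalCompact_le_carrier k) X ∈ pPart α β := by
  rw [mem_pPart_iff] at hX ⊢
  conv_lhs => rw [← upq_Ad_upqZ0 k, ← LieHom.map_lie, ← LieHom.map_lie, hX, map_neg]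

/-- **`𝔭 = Σ_s ℝ x_s`**: an element of `𝔭` is a real combination of the frame vectors (its `𝔨`-component in the Cartan
decomposition `𝔤 = 𝔨 + Σ_s ℝ x_s` vanishes, being killed by `J` and equal to `−J²` of itself). [cite: BorelWallach2000, II §1.1 (3)] -/
theorem exists_sum_upqPBasis_of_mem_pPart (X : (uFormGroup α β).lie) (hX : X ∈ pPart α β) :
    ∃ c : (α × β) × Fin 2 → ℝ, X = ∑ s, c s • upqPBasis s := by
  obtain ⟨k, hk, c, hXk⟩ := upq_exists_kInLie_add_sum_upqPBasis X
  refine ⟨c, ?_⟩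
  have hp : (∑ s, c s • upqPBasis s) ∈ pPart α β :=
    Submodule.sum_mem _ fun s _ => Submodule.smul_mem _ _ (upqPBasis_mem_pPart s)
  rw [mem_pPart_iff] at hX hp
  have h1 : ⁅upqZ0 α β, ⁅upqZ0 α β, X⁆⁆ = -∑ s, c s • upqPBasis s := by
    rw [hXk, lie_add, lie_add, lie_upqZ0_eq_zero_of_mem_kInLie k hk, lie_zero, zero_add, hp]
  rw [hX, neg_inj] at h1
  exact h1

end PPart

/-! ## §2 The raising ∕ nullity operators `pOp c X = ρX + c ρ(JX)` on a `(𝔤, K)`-module and their commutators -/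

section Operators

variable {V : Type} [AddCommGroup V] [Module ℂ V]
  (ρK : Representation ℂ (uFormGroup α β).maximalCompact V)
  (ρ𝔤 : (uFormGroup α β).lie →ₗ⁅ℝ⁆ Module.End ℂ V)

/-- **The operators `pOp c X = ρ𝔤 X + c · ρ𝔤 ⁅z₀, X⁆`** (`c = μ = δ i`: the `𝔭^{−δ}`-nullity operator `N` of the
line's `IsPNull`; `c = −μ`: the raising operator `P`, "the action of `𝔭^{δ}`" without complexifying `𝔤`).
[cite: BorelWallach2000, II §4.1] -/
def pOp (c : ℂ) (X : (uFormGroup α β).lie) : Module.End ℂ V := ρ𝔤 X + c • ρ𝔤 ⁅upqZ0 α β, X⁆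

/-- Unfolding. [cite: BorelWallach2000, II §4.1] -/
theorem pOp_apply (c : ℂ) (X : (uFormGroup α β).lie) (v : V) :
    pOp ρ𝔤 c X v = ρ𝔤 X v + c • ρ𝔤 ⁅upqZ0 α β, X⁆ v := rfl

/-- `pOp` is additive in `X`. [folklore] -/
theorem pOp_add (c : ℂ) (X Y : (uFormGroup α β).lie) : pOp ρ𝔤 c (X + Y) = pOp ρ𝔤 c X + pOp ρ𝔤 c Y := by
  simp only [pOp, lie_add, map_add, smul_add]
  abel

/-- `pOp` is real-homogeneous in `X`. [folklore] -/
theorem pOp_smul (c : ℂ) (r : ℝ) (X : (uFormGroup α β).lie) (v : V) :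
    pOp ρ𝔤 c (r • X) v = (r : ℂ) • pOp ρ𝔤 c X v := by
  simp only [pOp_apply, lie_smul, map_smul, LinearMap.smul_apply, smul_add, ← Complex.coe_smul, smul_smul,
    mul_comm c (r : ℂ)]

/-- `pOp` on a frame combination: `pOp c (Σ_s a_s x_s) v = Σ_s a_s · pOp c x_s v`. [folklore] -/
theorem pOp_sum_smul_apply (c : ℂ) {ι : Type} [Fintype ι] (a : ι → ℝ) (X : ι → (uFormGroup α β).lie) (v : V) :
    pOp ρ𝔤 c (∑ i, a i • X i) v = ∑ i, (a i : ℂ) • pOp ρ𝔤 c (X i) v := by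
  classical
  induction (Finset.univ : Finset ι) using Finset.induction_on with
  | empty => simp only [Finset.sum_empty, pOp_apply, map_zero, lie_zero, LinearMap.zero_apply, smul_zero, add_zero]
  | insert i s hi ih =>
    rw [Finset.sum_insert hi, Finset.sum_insert hi, pOp_add, LinearMap.add_apply, pOp_smul, ih]

/-- `2 ρ𝔤 X = pOp (−c) X + pOp c X`. [folklore] -/
theorem pOp_neg_add_pOp (c : ℂ) (X : (uFormGroup α β).lie) (v : V) :
    pOp ρ𝔤 (-c) X v + pOp ρ𝔤 c X v = (2 : ℂ) • ρ𝔤 X v := by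
  rw [pOp_apply, pOp_apply, neg_smul, two_smul]
  abel

/-- **`[ρz₀, pOp c X] = −c · pOp c X`** for `X ∈ 𝔭` and `c² = −1`: `P = pOp (−μ)` raises the `z₀`-weight by `μ`,
`N = pOp μ` lowers it by `μ`. [cite: BorelWallach2000, II §4.1] -/
theorem z0_pOp_apply {c : ℂ} (hc : c * c = -1) (X : (uFormGroup α β).lie) (hX : X ∈ pPart α β) (v : V) :
    ρ𝔤 (upqZ0 α β) (pOp ρ𝔤 c X v) = pOp ρ𝔤 c X (ρ𝔤 (upqZ0 α β) v) - c • pOp ρ𝔤 c X v := by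
  rw [mem_pPart_iff] at hX
  have h1 : ρ𝔤 (upqZ0 α β) (ρ𝔤 X v) = ρ𝔤 X (ρ𝔤 (upqZ0 α β) v) + ρ𝔤 ⁅upqZ0 α β, X⁆ v := by
    have e := LinearMap.congr_fun (LieHom.map_lie ρ𝔤 (upqZ0 α β) X) v
    rw [Ring.lie_def, LinearMap.sub_apply, Module.End.mul_apply, Module.End.mul_apply] at e
    rw [e]; abel
  have h2 : ρ𝔤 (upqZ0 α β) (ρ𝔤 ⁅upqZ0 α β, X⁆ v) = ρ𝔤 ⁅upqZ0 α β, X⁆ (ρ𝔤 (upqZ0 α β) v) - ρ𝔤 X v := by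
    have e := LinearMap.congr_fun (LieHom.map_lie ρ𝔤 (upqZ0 α β) ⁅upqZ0 α β, X⁆) v
    rw [hX, map_neg, Ring.lie_def, LinearMap.sub_apply, Module.End.mul_apply, Module.End.mul_apply,
      LinearMap.neg_apply] at e
    rw [sub_eq_iff_eq_add.1 e.symm]; abel
  rw [pOp_apply, pOp_apply, map_add, map_smul, h1, h2]
  simp only [smul_sub, smul_add, smul_smul, hc, neg_smul, one_smul]
  abel

/-- **`[ρW, pOp c X] = pOp c ⁅W, X⁆` for `W ∈ 𝔨`** (`J` commutes with `ad W`). [cite: BorelWallach2000, II §4.1] -/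
theorem lieK_pOp_apply (c : ℂ) (W : (uFormGroup α β).lie) (hW : W ∈ (uFormGroup α β).kInLie)
    (X : (uFormGroup α β).lie) (v : V) :
    ρ𝔤 W (pOp ρ𝔤 c X v) = pOp ρ𝔤 c X (ρ𝔤 W v) + pOp ρ𝔤 c ⁅W, X⁆ v := by
  have h : ∀ Y : (uFormGroup α β).lie, ρ𝔤 W (ρ𝔤 Y v) = ρ𝔤 Y (ρ𝔤 W v) + ρ𝔤 ⁅W, Y⁆ v := by
    intro Y
    have e := LinearMap.congr_fun (LieHom.map_lie ρ𝔤 W Y) v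
    rw [Ring.lie_def, LinearMap.sub_apply, Module.End.mul_apply, Module.End.mul_apply] at e
    rw [e]; abel
  rw [pOp_apply, pOp_apply, pOp_apply, map_add, map_smul, h X, h ⁅upqZ0 α β, X⁆,
    ← lie_upqZ0_lie_of_mem_kInLie W hW X, smul_add]
  abel

/-- **`ρK k ∘ pOp c X = pOp c (Ad k X) ∘ ρK k`** (the `(𝔤, K)`-axiom `ad_compat` and `Ad k z₀ = z₀`).
[cite: BorelWallach2000, I §5.1 (1); II §4.1] -/
theorem K_pOp_apply
    (hV : ∀ (k : (uFormGroup α β).maximalCompact) (X : (uFormGroup α β).lie), ρK k ∘ₗ ρ𝔤 X ∘ₗ ρK k⁻¹ =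
      ρ𝔤 ((uFormGroup α β).Ad (Subgroup.inclusion (uFormGroup α β).maximalCompact_le_carrier k) X))
    (c : ℂ) (k : (uFormGroup α β).maximalCompact) (X : (uFormGroup α β).lie) (v : V) :
    ρK k (pOp ρ𝔤 c X v) =
      pOp ρ𝔤 c ((uFormGroup α β).Ad (Subgroup.inclusion (uFormGroup α β).maximalCompact_le_carrier k) X) (ρK k v) := by
  have h : ∀ Y : (uFormGroup α β).lie, ρK k (ρ𝔤 Y v) =
      ρ𝔤 ((uFormGroup α β).Ad (Subgroup.inclusion (uFormGroup α β).maximalCompact_le_carrier k) Y) (ρK k v) :=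
    fun Y => (gkPairAction (uFormGroup α β) ρK ρ𝔤 hV).compat k Y v
  rw [pOp_apply, pOp_apply, map_add, map_smul, h X, h ⁅upqZ0 α β, X⁆, LieHom.map_lie, upq_Ad_upqZ0]

/-- For `X, Y ∈ 𝔭` all four brackets `⁅X, Y⁆, ⁅X, JY⁆, ⁅JX, Y⁆, ⁅JX, JY⁆` lie in `𝔨` (`[𝔭, 𝔭] ⊆ 𝔨`).
[cite: BorelWallach2000, II §4.1] -/
theorem lie_mem_kInLie_of_mem_pPart (X Y : (uFormGroup α β).lie) (hX : X ∈ pPart α β) (hY : Y ∈ pPart α β) :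
    ⁅X, Y⁆ ∈ (uFormGroup α β).kInLie ∧ ⁅X, ⁅upqZ0 α β, Y⁆⁆ ∈ (uFormGroup α β).kInLie ∧
      ⁅⁅upqZ0 α β, X⁆, Y⁆ ∈ (uFormGroup α β).kInLie ∧ ⁅⁅upqZ0 α β, X⁆, ⁅upqZ0 α β, Y⁆⁆ ∈ (uFormGroup α β).kInLie := by
  have hJJ := upq_isComplexStructureElement (α := α) (β := β) |>.lie_lie_lie_mem
  rw [mem_pPart_iff] at hX hY
  refine ⟨?_, ?_, ?_, hJJ X Y⟩
  · rw [show ⁅X, Y⁆ = ⁅⁅upqZ0 α β, ⁅upqZ0 α β, X⁆⁆, ⁅upqZ0 α β, ⁅upqZ0 α β, Y⁆⁆⁆ by rw [hX, hY, neg_lie, lie_neg, neg_neg]]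
    exact hJJ _ _
  · rw [show ⁅X, ⁅upqZ0 α β, Y⁆⁆ = -⁅⁅upqZ0 α β, ⁅upqZ0 α β, X⁆⁆, ⁅upqZ0 α β, Y⁆⁆ by rw [hX, neg_lie, neg_neg]]
    exact Submodule.neg_mem _ (hJJ _ _)
  · rw [show ⁅⁅upqZ0 α β, X⁆, Y⁆ = -⁅⁅upqZ0 α β, X⁆, ⁅upqZ0 α β, ⁅upqZ0 α β, Y⁆⁆⁆ by rw [hY, lie_neg, neg_neg]]
    exact Submodule.neg_mem _ (hJJ _ _)

/-- **`[pOp c X, pOp c' Y] ∈ ρ(𝔨) + ℂ ρ(𝔨)`** for `X, Y ∈ 𝔭`: inside any `𝔨`-stable complex subspace `S`,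
`pOp c X (pOp c' Y v) − pOp c' Y (pOp c X v) ∈ S` for `v ∈ S`. [cite: BorelWallach2000, II §4.1] -/
theorem pOp_comm_mem (S : Submodule ℂ V) (hS : ∀ W ∈ (uFormGroup α β).kInLie, ∀ u ∈ S, ρ𝔤 W u ∈ S)
    (c c' : ℂ) (X Y : (uFormGroup α β).lie) (hX : X ∈ pPart α β) (hY : Y ∈ pPart α β) (v : V) (hv : v ∈ S) :
    pOp ρ𝔤 c X (pOp ρ𝔤 c' Y v) - pOp ρ𝔤 c' Y (pOp ρ𝔤 c X v) ∈ S := by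
  obtain ⟨h1, h2, h3, h4⟩ := lie_mem_kInLie_of_mem_pPart X Y hX hY
  have h : ∀ A B : (uFormGroup α β).lie, ρ𝔤 A (ρ𝔤 B v) - ρ𝔤 B (ρ𝔤 A v) = ρ𝔤 ⁅A, B⁆ v := by
    intro A B
    have e := LinearMap.congr_fun (LieHom.map_lie ρ𝔤 A B) v
    rw [Ring.lie_def, LinearMap.sub_apply, Module.End.mul_apply, Module.End.mul_apply] at e
    exact e.symm
  have key : pOp ρ𝔤 c X (pOp ρ𝔤 c' Y v) - pOp ρ𝔤 c' Y (pOp ρ𝔤 c X v) =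
      ρ𝔤 ⁅X, Y⁆ v + c' • ρ𝔤 ⁅X, ⁅upqZ0 α β, Y⁆⁆ v + c • ρ𝔤 ⁅⁅upqZ0 α β, X⁆, Y⁆ v +
        (c * c') • ρ𝔤 ⁅⁅upqZ0 α β, X⁆, ⁅upqZ0 α β, Y⁆⁆ v := by
    rw [← h X Y, ← h X ⁅upqZ0 α β, Y⁆, ← h ⁅upqZ0 α β, X⁆ Y, ← h ⁅upqZ0 α β, X⁆ ⁅upqZ0 α β, Y⁆]
    simp only [pOp_apply, map_add, map_smul, smul_add, smul_sub, smul_smul, mul_comm c' c]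
    abel
  rw [key]
  refine Submodule.add_mem _ (Submodule.add_mem _ (Submodule.add_mem _ (hS _ h1 v hv) ?_) ?_) ?_
  · exact Submodule.smul_mem _ _ (hS _ h2 v hv)
  · exact Submodule.smul_mem _ _ (hS _ h3 v hv)
  · exact Submodule.smul_mem _ _ (hS _ h4 v hv)

end Operators

end Summit.HodgeConjecture.HodgeConjecture.Cruxes.H413.F0P3bPPartOperators

end
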